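import Literature.NumberTheory.Sieve.PolymathBoundedGapsM50OrbitalCert
import Literature.NumberTheory.Sieve.PolymathBoundedGapsM50OrbitalTables
import HarnessLib

/-!
# `M_{50,1/27} > 4`, kernel-pure — per-pair kernel facts, batch 4/6

Part of the kernel-pure certificate **`M_{50,1/27} > 4`** (parity-ideate cell, ROUND-24 «ALS-ORBITAL», certificate E1 T_3 =
`ALS_r3_cert.json`, sha16 d9bc336f5c4ec53f, λ = 4.000110928047049…, independently verified by the cell's `verify_indep.py` and
reproduced EXACTLY by the Literature mirror `symcert/mirror.py`): a labelled product-radial test function on `(1+ε)·R_50`,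
`ε = 1/27`, base profile `g` (degree 6) and three orbitals `o1, o2, o3` (degree ≤ 19, dyadic, common scale `2^-50`), eleven
excitation multisets `∅, o1, o2, o3, o1o1, o1o2, o1o3, o2o2, o2o3, o3o3, o1o1o1` with integer radial polynomials of degree ≤ 14.
Checked by `SymLCert.sound_tab` (`PolymathSymLCert.lean`): files `PolymathBoundedGapsM50OrbitalCert` (data), `PolymathBoundedGapsM50OrbitalTI1…TI5/TJ1…TJ5` (the
claimed pair numerators), `PolymathBoundedGapsM50OrbitalTables` (dispatch), `PolymathBoundedGapsM50OrbitalPairs1…` (one `decide +kernel` per lower-triangle pair),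
`PolymathBoundedGapsM50OrbitalMain` (assembly: `exists_polymathFunctional_50_gt_four`, standard axioms — no `Lean.ofReduceBool`).

The kernel facts are elaborated SEQUENTIALLY (`Elab.async false`): each `decide +kernel` holds ≈ 10⁸ bytes of cached big integers, so parallel proof elaboration would exceed the per-file memory budget.

## References
* D. H. J. Polymath, *Variants of the Selberg sieve, and bounded intervals containing many primes*, Res. Math. Sci. 1 (2014),
  Art. 12 = arXiv:1407.4897: Theorem 3.13 / eq. (35) (numerical lower bounds for `M_{k,ε}`), §7 (the test-function algebra),
  Theorem 1.4(i) (`H₁ ≤ 246` from `M_{50,ε} > 4`). [Polymath8b2014]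
-/

set_option Elab.async false

namespace Literature.NumberTheory.Sieve.PolymathCert

namespace PolymathM50Orbital

/-- kernel fact: J-side pair (0,0) is valid and has numerator `tJ 0 0`. [cite: Polymath8b2014, Theorem 3.13, eq. (35)] -/
theorem okJ_0_0 : cert.okJ 0 0 (tJ 0 0) = true := by decide +kernel

/-- kernel fact: J-side pair (1,0) is valid and has numerator `tJ 1 0`. [cite: Polymath8b2014, Theorem 3.13, eq. (35)] -/
theorem okJ_1_0 : cert.okJ 1 0 (tJ 1 0) = true := by decide +kernel

/-- kernel fact: J-side pair (1,1) is valid and has numerator `tJ 1 1`. [cite: Polymath8b2014, Theorem 3.13, eq. (35)] -/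
theorem okJ_1_1 : cert.okJ 1 1 (tJ 1 1) = true := by decide +kernel

/-- kernel fact: J-side pair (2,0) is valid and has numerator `tJ 2 0`. [cite: Polymath8b2014, Theorem 3.13, eq. (35)] -/
theorem okJ_2_0 : cert.okJ 2 0 (tJ 2 0) = true := by decide +kernel

/-- kernel fact: J-side pair (2,1) is valid and has numerator `tJ 2 1`. [cite: Polymath8b2014, Theorem 3.13, eq. (35)] -/
theorem okJ_2_1 : cert.okJ 2 1 (tJ 2 1) = true := by decide +kernel

/-- kernel fact: J-side pair (2,2) is valid and has numerator `tJ 2 2`. [cite: Polymath8b2014, Theorem 3.13, eq. (35)] -/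
theorem okJ_2_2 : cert.okJ 2 2 (tJ 2 2) = true := by decide +kernel

/-- kernel fact: J-side pair (3,0) is valid and has numerator `tJ 3 0`. [cite: Polymath8b2014, Theorem 3.13, eq. (35)] -/
theorem okJ_3_0 : cert.okJ 3 0 (tJ 3 0) = true := by decide +kernel

/-- kernel fact: J-side pair (3,1) is valid and has numerator `tJ 3 1`. [cite: Polymath8b2014, Theorem 3.13, eq. (35)] -/
theorem okJ_3_1 : cert.okJ 3 1 (tJ 3 1) = true := by decide +kernel

/-- kernel fact: J-side pair (3,2) is valid and has numerator `tJ 3 2`. [cite: Polymath8b2014, Theorem 3.13, eq. (35)] -/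
theorem okJ_3_2 : cert.okJ 3 2 (tJ 3 2) = true := by decide +kernel

/-- kernel fact: J-side pair (3,3) is valid and has numerator `tJ 3 3`. [cite: Polymath8b2014, Theorem 3.13, eq. (35)] -/
theorem okJ_3_3 : cert.okJ 3 3 (tJ 3 3) = true := by decide +kernel

/-- kernel fact: J-side pair (4,0) is valid and has numerator `tJ 4 0`. [cite: Polymath8b2014, Theorem 3.13, eq. (35)] -/
theorem okJ_4_0 : cert.okJ 4 0 (tJ 4 0) = true := by decide +kernel

/-- kernel fact: J-side pair (4,1) is valid and has numerator `tJ 4 1`. [cite: Polymath8b2014, Theorem 3.13, eq. (35)] -/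
theorem okJ_4_1 : cert.okJ 4 1 (tJ 4 1) = true := by decide +kernel

/-- kernel fact: J-side pair (4,2) is valid and has numerator `tJ 4 2`. [cite: Polymath8b2014, Theorem 3.13, eq. (35)] -/
theorem okJ_4_2 : cert.okJ 4 2 (tJ 4 2) = true := by decide +kernel

/-- kernel fact: J-side pair (4,3) is valid and has numerator `tJ 4 3`. [cite: Polymath8b2014, Theorem 3.13, eq. (35)] -/
theorem okJ_4_3 : cert.okJ 4 3 (tJ 4 3) = true := by decide +kernel

/-- kernel fact: J-side pair (4,4) is valid and has numerator `tJ 4 4`. [cite: Polymath8b2014, Theorem 3.13, eq. (35)] -/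
theorem okJ_4_4 : cert.okJ 4 4 (tJ 4 4) = true := by decide +kernel

/-- kernel fact: J-side pair (5,0) is valid and has numerator `tJ 5 0`. [cite: Polymath8b2014, Theorem 3.13, eq. (35)] -/
theorem okJ_5_0 : cert.okJ 5 0 (tJ 5 0) = true := by decide +kernel

/-- kernel fact: J-side pair (5,1) is valid and has numerator `tJ 5 1`. [cite: Polymath8b2014, Theorem 3.13, eq. (35)] -/
theorem okJ_5_1 : cert.okJ 5 1 (tJ 5 1) = true := by decide +kernel

/-- kernel fact: J-side pair (5,2) is valid and has numerator `tJ 5 2`. [cite: Polymath8b2014, Theorem 3.13, eq. (35)] -/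
theorem okJ_5_2 : cert.okJ 5 2 (tJ 5 2) = true := by decide +kernel

/-- kernel fact: J-side pair (5,3) is valid and has numerator `tJ 5 3`. [cite: Polymath8b2014, Theorem 3.13, eq. (35)] -/
theorem okJ_5_3 : cert.okJ 5 3 (tJ 5 3) = true := by decide +kernel

/-- kernel fact: J-side pair (5,4) is valid and has numerator `tJ 5 4`. [cite: Polymath8b2014, Theorem 3.13, eq. (35)] -/
theorem okJ_5_4 : cert.okJ 5 4 (tJ 5 4) = true := by decide +kernel

/-- kernel fact: J-side pair (5,5) is valid and has numerator `tJ 5 5`. [cite: Polymath8b2014, Theorem 3.13, eq. (35)] -/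
theorem okJ_5_5 : cert.okJ 5 5 (tJ 5 5) = true := by decide +kernel

/-- kernel fact: J-side pair (6,0) is valid and has numerator `tJ 6 0`. [cite: Polymath8b2014, Theorem 3.13, eq. (35)] -/
theorem okJ_6_0 : cert.okJ 6 0 (tJ 6 0) = true := by decide +kernel

end PolymathM50Orbital

end Literature.NumberTheory.Sieve.PolymathCert
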